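import Mathlib
import HarnessLib
import Summits.Ventures.LatticeQCDFlow.Scaling.GiniMeanDifferenceVarianceBounds
import Summits.Ventures.LatticeQCDFlow.Scaling.KurtosisIndependentSum

/-!
# LatticeQCDFlow / Scaling — the SU(2) strong-coupling slope is pinned to `√V`:
# `√(V/24) ≤ s_V ≤ √(V/12)` for the untrained factorised `V`-plaquette sampler

HONEST FRAMING: exact (Metropolis-corrected) sampling algorithms for lattice gauge theory;
figures of merit are autocorrelation/cost numbers at stated couplings and volumes; no
continuum-physics claim.

Venture `LatticeQCDFlow` (cell pub-lqcd), topic `Scaling`; FANOUT row 3 (`s0-u1-a`, S0-B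
implementation A, GEN-18).  NEW WORK of the cell (assembly), not a published result; NO definition is
introduced.  Parents (all in the tree): row 3's `Scaling/GiniMeanDifferenceVarianceBounds` (the
sandwich `√(Var/6) ≤ ½E|T − T′| ≤ √(Var/3)` at kurtosis `≤ 3`, `T` bounded below) and
`Scaling/KurtosisIndependentSum` (`pi_sum_moments`: centred platykurtic independent sums stay
platykurtic); Mathlib's reduction formulae for `∫ cosⁿ`, `∫ sin² cos²`.

Setting: `V = #ι` class angles `αᵢ ∈ (0, π]`, i.i.d. with the SU(2) CLASS-ANGLE (Weyl) probability
`ν₂ = (2/π) sin²α dα` (the law of the class angle of a Haar-random `SU(2)` element; `½ tr U = cos α`),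
`T = Σᵢ cos αᵢ` (the factorised strong-coupling model of the SU(2) action in the normalisation of
GEN-17 (O) `Scaling/SU2IdentityFlowAcceptanceStrongCoupling`), and the HALF GINI MEAN DIFFERENCE
`s_V = ½·E|T − T′|` of two independent copies under `Measure.pi (fun _ => ν₂)` — by GEN-17 (O) this is
the strong-coupling slope of the untrained factorised SU(2) sampler (that identification, stated for
O's product density `Q·Leb^{⊗V}`, is NOT restated here; this file is the measure-theoretic core in the
`Measure.pi` normalisation).

* §1 the one-angle law: `su2ClassDensity_facts`, `integral_su2ClassOne`, `intervalIntegral_su2ClassDensity`,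
  `su2ClassOne_isProbabilityMeasure`, the moments `∫₀^π sin² cos = 0`, `∫₀^π cos⁴ = 3π/8`, `∫₀^π cos⁶ = 5π/16`,
  `∫₀^π sin² cos² = π/8`, `∫₀^π sin² cos⁴ = π/16`, hence **`cos_su2ClassOne_moments`** (`E cos = 0`,
  `E cos² = ¼`, `E cos⁴ = ⅛`: kurtosis `2`) and `memLp_four_cos_su2ClassOne`;
* §2 `su2Pi_sum_cos_moments` (`E T = 0`, `E T² = V/4`, `E T⁴ ≤ 3(E T²)²`), `su2Pi_sum_cos_variance`
  (`Var T = V/4`), `su2Pi_sum_cos_centralFourth_le`;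
* §3 **`su2Pi_slope_ge_sqrt_card_div_twentyfour`** (`√(V/24) ≤ s_V`), **`su2Pi_slope_le_sqrt_card_div_twelve`**
  (`s_V ≤ √(V/12)`), **`su2Pi_slope_volume_sandwich`** — `s_V/√V ∈ [1/√24, 1/√12] ≈ [0.204, 0.289]` for
  EVERY `V ≥ 1` (at `V = 1` the exact value is `128/(45π²) ≈ 0.288`, `Scaling/SU2CosineGiniConstant`).

Reading (value-free): as for U(1) (`Scaling/U1IdentityFlowSlopeVolumeSandwich`, constants `1/√12`,
`1/√6`), the SU(2) slope grows like `√V`, with HALF the U(1) variance per plaquette (`¼` against `½`).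
NOT CLAIMED: the CLT limit `s_V/√V → 1/(2√π)`; the torus; any value at the cell's `(β, L)`; nothing
re-scored.
-/

noncomputable section

namespace Summit.Ventures.LatticeQCDFlow.Theory2

open MeasureTheory Real Set ProbabilityTheory Filter Topology Finset

/-! ## §1 The one-angle class law `(2/π) sin²α dα` on `(0, π]` -/

section One

/-- The class-angle density is non-negative, measurable, continuous and bounded by `2/π`. [folklore] -/
theorem su2ClassDensity_facts :
    (∀ α : ℝ, 0 ≤ 2 / π * Real.sin α ^ 2) ∧ (Measurable fun α : ℝ => 2 / π * Real.sin α ^ 2)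
      ∧ (Continuous fun α : ℝ => 2 / π * Real.sin α ^ 2)
      ∧ (∀ α : ℝ, 2 / π * Real.sin α ^ 2 ≤ 2 / π) := by
  refine ⟨fun α => by positivity, (measurable_const.mul (Real.measurable_sin.pow_const 2)),
    continuous_const.mul (Real.continuous_sin.pow 2), fun α => ?_⟩
  have h := Real.sin_sq_le_one α
  have hπ : 0 < 2 / π := by positivity
  nlinarith

/-- Integration against `ν₂ = (2/π)sin²·Leb|(0,π]`: `∫ f dν₂ = ∫₀^π (2/π) sin²α · f α dα`. [folklore] -/
theorem integral_su2ClassOne (f : ℝ → ℝ) :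
    ∫ α, f α ∂((volume.restrict (Ioc (0 : ℝ) π)).withDensity
        fun α => ENNReal.ofReal (2 / π * Real.sin α ^ 2))
      = ∫ α in (0 : ℝ)..π, 2 / π * Real.sin α ^ 2 * f α := by
  obtain ⟨hq, hqm, -, -⟩ := su2ClassDensity_facts
  rw [integral_withDensity_eq_integral_toReal_smul hqm.ennreal_ofReal
    (ae_of_all _ fun _ => ENNReal.ofReal_lt_top), intervalIntegral.integral_of_le Real.pi_pos.le]
  exact integral_congr_ae (ae_of_all _ fun α => by
    simp only [smul_eq_mul, ENNReal.toReal_ofReal (hq α)])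

/-- `∫₀^π (2/π) sin²α dα = 1`. [folklore] -/
theorem intervalIntegral_su2ClassDensity : ∫ α in (0 : ℝ)..π, 2 / π * Real.sin α ^ 2 = 1 := by
  rw [intervalIntegral.integral_const_mul, integral_sin_sq, Real.sin_zero, Real.sin_pi]
  have hπ : π ≠ 0 := Real.pi_ne_zero
  field_simp
  ring

/-- `ν₂` is a probability measure. [folklore] -/
theorem su2ClassOne_isProbabilityMeasure :
    IsProbabilityMeasure ((volume.restrict (Ioc (0 : ℝ) π)).withDensity
      fun α => ENNReal.ofReal (2 / π * Real.sin α ^ 2)) := by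
  constructor
  have h := integral_su2ClassOne (fun _ => (1 : ℝ))
  simp only [mul_one, intervalIntegral_su2ClassDensity] at h
  -- `∫ 1 dν₂ = 1` ⇒ total mass `1`
  have hfin : ((volume.restrict (Ioc (0 : ℝ) π)).withDensity
      fun α => ENNReal.ofReal (2 / π * Real.sin α ^ 2)) univ ≠ ⊤ := by
    obtain ⟨hq, hqm, hqc, hqb⟩ := su2ClassDensity_facts
    rw [withDensity_apply _ MeasurableSet.univ, Measure.restrict_univ]
    refine ne_of_lt (lt_of_le_of_lt (lintegral_mono (fun α => ENNReal.ofReal_le_ofReal (hqb α))) ?_)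
    rw [lintegral_const, Measure.restrict_apply_univ, Real.volume_Ioc]
    exact ENNReal.mul_lt_top ENNReal.ofReal_lt_top ENNReal.ofReal_lt_top
  have h1 := h
  rw [integral_const, smul_eq_mul, mul_one, Measure.real, ENNReal.toReal_eq_one_iff] at h1
  exact h1

/-- `∫₀^π sin²α cos α dα = 0`. [folklore] -/
theorem intervalIntegral_sin_sq_mul_cos : ∫ α in (0 : ℝ)..π, Real.sin α ^ 2 * Real.cos α = 0 := by
  have h := integral_sin_pow_mul_cos_pow_odd (a := 0) (b := π) 2 0
  simp only [mul_zero, zero_add, pow_one, pow_zero, mul_one, Real.sin_zero, Real.sin_pi,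
    intervalIntegral.integral_same] at h
  exact h

/-- `∫₀^π cos⁴ = 3π/8` and `∫₀^π cos⁶ = 5π/16` (reduction formula). [folklore] -/
theorem intervalIntegral_cos_pow_four_six :
    (∫ α in (0 : ℝ)..π, Real.cos α ^ 4 = 3 * π / 8) ∧ (∫ α in (0 : ℝ)..π, Real.cos α ^ 6 = 5 * π / 16) := by
  have h2 : ∫ α in (0 : ℝ)..π, Real.cos α ^ 2 = π / 2 := by
    rw [integral_cos_sq, Real.sin_zero, Real.sin_pi]; ring
  have h4 := integral_cos_pow (a := 0) (b := π) (n := 2)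
  rw [show (2 : ℕ) + 2 = 4 by norm_num, h2, Real.sin_zero, Real.sin_pi] at h4
  have h4' : ∫ α in (0 : ℝ)..π, Real.cos α ^ 4 = 3 * π / 8 := by
    rw [h4]; push_cast; ring
  have h6 := integral_cos_pow (a := 0) (b := π) (n := 4)
  rw [show (4 : ℕ) + 2 = 6 by norm_num, h4', Real.sin_zero, Real.sin_pi] at h6
  refine ⟨h4', ?_⟩
  rw [h6]; push_cast; ring

/-- `∫₀^π sin²α cos²α dα = π/8`. [folklore] -/
theorem intervalIntegral_sin_sq_mul_cos_sq' :
    ∫ α in (0 : ℝ)..π, Real.sin α ^ 2 * Real.cos α ^ 2 = π / 8 := by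
  rw [integral_sin_sq_mul_cos_sq, mul_zero, Real.sin_zero, show (4 : ℝ) * π = ((4 : ℕ) : ℝ) * π by
    push_cast; ring, Real.sin_nat_mul_pi]
  ring

/-- `∫₀^π sin²α cos⁴α dα = π/16` (`sin²cos⁴ = cos⁴ − cos⁶`). [folklore] -/
theorem intervalIntegral_sin_sq_mul_cos_pow_four :
    ∫ α in (0 : ℝ)..π, Real.sin α ^ 2 * Real.cos α ^ 4 = π / 16 := by
  obtain ⟨h4, h6⟩ := intervalIntegral_cos_pow_four_six
  have e : (fun α => Real.sin α ^ 2 * Real.cos α ^ 4) = fun α => Real.cos α ^ 4 - Real.cos α ^ 6 := by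
    funext α
    have hs : Real.sin α ^ 2 = 1 - Real.cos α ^ 2 := by linarith [Real.sin_sq_add_cos_sq α]
    rw [hs]; ring
  rw [e, intervalIntegral.integral_sub ((by fun_prop : Continuous fun α => Real.cos α ^ 4).intervalIntegrable _ _)
    ((by fun_prop : Continuous fun α => Real.cos α ^ 6).intervalIntegrable _ _), h4, h6]
  ring

/-- **Moments of `cos α` under the one-angle class law `ν₂`**: `E cos = 0`, `E cos² = ¼`,
`E cos⁴ = ⅛` (kurtosis `2`). [folklore] -/
theorem cos_su2ClassOne_moments :
    (∫ α, Real.cos α ∂((volume.restrict (Ioc (0 : ℝ) π)).withDensity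
        fun α => ENNReal.ofReal (2 / π * Real.sin α ^ 2)) = 0)
      ∧ (∫ α, Real.cos α ^ 2 ∂((volume.restrict (Ioc (0 : ℝ) π)).withDensity
        fun α => ENNReal.ofReal (2 / π * Real.sin α ^ 2)) = 1 / 4)
      ∧ (∫ α, Real.cos α ^ 4 ∂((volume.restrict (Ioc (0 : ℝ) π)).withDensity
        fun α => ENNReal.ofReal (2 / π * Real.sin α ^ 2)) = 1 / 8) := by
  have hπ : π ≠ 0 := Real.pi_ne_zero
  refine ⟨?_, ?_, ?_⟩
  · rw [integral_su2ClassOne]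
    simp_rw [mul_assoc]
    rw [intervalIntegral.integral_const_mul, intervalIntegral_sin_sq_mul_cos, mul_zero]
  · rw [integral_su2ClassOne]
    simp_rw [mul_assoc]
    rw [intervalIntegral.integral_const_mul, intervalIntegral_sin_sq_mul_cos_sq']
    field_simp; ring
  · rw [integral_su2ClassOne]
    simp_rw [mul_assoc]
    rw [intervalIntegral.integral_const_mul, intervalIntegral_sin_sq_mul_cos_pow_four]
    field_simp; ring

/-- `cos ∈ L⁴(ν₂)`. [folklore] -/
theorem memLp_four_cos_su2ClassOne :
    MemLp (fun α => Real.cos α) 4 ((volume.restrict (Ioc (0 : ℝ) π)).withDensity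
      fun α => ENNReal.ofReal (2 / π * Real.sin α ^ 2)) := by
  haveI := su2ClassOne_isProbabilityMeasure
  exact MemLp.of_bound Real.continuous_cos.aestronglyMeasurable 1
    (ae_of_all _ fun α => by rw [Real.norm_eq_abs]; exact Real.abs_cos_le_one α)

end One


/-! ## §2 `T = Σᵢ cos αᵢ` under `Measure.pi (fun _ => ν₂)` -/

section Pi

variable {ι : Type*} [Fintype ι]

/-- **Moments of `T = Σᵢ cos αᵢ` under the product class-angle law**: `T ∈ L⁴`, `E T = 0`,
`E T² = V/4`, `E T⁴ ≤ 3(E T²)²`. [ours] -/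
theorem su2Pi_sum_cos_moments :
    MemLp (fun x : ι → ℝ => ∑ i, Real.cos (x i)) 4
        (Measure.pi fun _ : ι => (volume.restrict (Ioc (0 : ℝ) π)).withDensity
          fun α => ENNReal.ofReal (2 / π * Real.sin α ^ 2))
      ∧ ∫ x, (∑ i, Real.cos (x i))
          ∂(Measure.pi fun _ : ι => (volume.restrict (Ioc (0 : ℝ) π)).withDensity
          fun α => ENNReal.ofReal (2 / π * Real.sin α ^ 2)) = 0
      ∧ ∫ x, (∑ i, Real.cos (x i)) ^ 2
          ∂(Measure.pi fun _ : ι => (volume.restrict (Ioc (0 : ℝ) π)).withDensity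
          fun α => ENNReal.ofReal (2 / π * Real.sin α ^ 2)) = Fintype.card ι / 4
      ∧ ∫ x, (∑ i, Real.cos (x i)) ^ 4
          ∂(Measure.pi fun _ : ι => (volume.restrict (Ioc (0 : ℝ) π)).withDensity
          fun α => ENNReal.ofReal (2 / π * Real.sin α ^ 2))
        ≤ 3 * (∫ x, (∑ i, Real.cos (x i)) ^ 2
          ∂(Measure.pi fun _ : ι => (volume.restrict (Ioc (0 : ℝ) π)).withDensity
          fun α => ENNReal.ofReal (2 / π * Real.sin α ^ 2))) ^ 2 := by
  haveI := su2ClassOne_isProbabilityMeasure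
  obtain ⟨m0, m2, m4⟩ := cos_su2ClassOne_moments
  have h := pi_sum_moments
    (μ := fun _ : ι => (volume.restrict (Ioc (0 : ℝ) π)).withDensity
      fun α => ENNReal.ofReal (2 / π * Real.sin α ^ 2))
    (X := fun _ α => Real.cos α) (fun _ => Real.measurable_cos) (fun _ => memLp_four_cos_su2ClassOne)
    (fun _ => m0) (fun _ => by rw [m4, m2]; norm_num)
  obtain ⟨hL, h0, h2, h4⟩ := h
  refine ⟨hL, h0, ?_, h4⟩
  rw [h2]
  simp only [m2, sum_const, card_univ]
  ring

/-- `Var(Σᵢ cos αᵢ) = V/4` under the product class-angle law. [ours] -/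
theorem su2Pi_sum_cos_variance :
    variance (fun x : ι → ℝ => ∑ i, Real.cos (x i))
        (Measure.pi fun _ : ι => (volume.restrict (Ioc (0 : ℝ) π)).withDensity
          fun α => ENNReal.ofReal (2 / π * Real.sin α ^ 2))
      = Fintype.card ι / 4 := by
  haveI := su2ClassOne_isProbabilityMeasure
  obtain ⟨hL, h0, h2, -⟩ := su2Pi_sum_cos_moments (ι := ι)
  rw [variance_eq_sub (hL.mono_exponent (by norm_num)), h0]
  simp only [Pi.pow_apply]
  rw [h2]
  ring

/-- `E(T − E T)⁴ ≤ 3·(Var T)²` for `T = Σᵢ cos αᵢ` under the product class-angle law. [ours] -/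
theorem su2Pi_sum_cos_centralFourth_le :
    ∫ x, ((∑ i, Real.cos (x i)) - ∫ y, ∑ i, Real.cos (y i)
        ∂(Measure.pi fun _ : ι => (volume.restrict (Ioc (0 : ℝ) π)).withDensity
          fun α => ENNReal.ofReal (2 / π * Real.sin α ^ 2))) ^ 4
        ∂(Measure.pi fun _ : ι => (volume.restrict (Ioc (0 : ℝ) π)).withDensity
          fun α => ENNReal.ofReal (2 / π * Real.sin α ^ 2))
      ≤ 3 * (variance (fun x : ι → ℝ => ∑ i, Real.cos (x i))
        (Measure.pi fun _ : ι => (volume.restrict (Ioc (0 : ℝ) π)).withDensity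
          fun α => ENNReal.ofReal (2 / π * Real.sin α ^ 2))) ^ 2 := by
  haveI := su2ClassOne_isProbabilityMeasure
  obtain ⟨hL, h0, h2, h4⟩ := su2Pi_sum_cos_moments (ι := ι)
  rw [h0, su2Pi_sum_cos_variance]
  simp only [sub_zero]
  rw [h2] at h4
  exact h4

end Pi

/-! ## §3 The volume law of the SU(2) slope, both sides -/

section Slope

variable {ι : Type*} [Fintype ι]

/-- **`√(V/24) ≤ s_V`** (Lyapunov lower bound at kurtosis `≤ 3`, `Var = V/4`). [ours] -/
theorem su2Pi_slope_ge_sqrt_card_div_twentyfour :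
    Real.sqrt (Fintype.card ι / 24)
      ≤ 1 / 2 * ∫ x, ∫ x', |∑ i, Real.cos (x i) - ∑ i, Real.cos (x' i)|
          ∂(Measure.pi fun _ : ι => (volume.restrict (Ioc (0 : ℝ) π)).withDensity
          fun α => ENNReal.ofReal (2 / π * Real.sin α ^ 2))
          ∂(Measure.pi fun _ : ι => (volume.restrict (Ioc (0 : ℝ) π)).withDensity
          fun α => ENNReal.ofReal (2 / π * Real.sin α ^ 2)) := by
  haveI := su2ClassOne_isProbabilityMeasure
  obtain ⟨hL, -, -, -⟩ := su2Pi_sum_cos_moments (ι := ι)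
  have hTm : Measurable fun x : ι → ℝ => ∑ i, Real.cos (x i) :=
    Finset.measurable_sum _ fun i _ => Real.measurable_cos.comp (measurable_pi_apply i)
  have h := sqrt_variance_div_six_le_half_integral_abs_sub hTm hL su2Pi_sum_cos_centralFourth_le
  rw [su2Pi_sum_cos_variance] at h
  calc Real.sqrt (Fintype.card ι / 24) = Real.sqrt (Fintype.card ι / 4 / 6) := by
        rw [div_div]; norm_num
    _ ≤ _ := h

/-- **`s_V ≤ √(V/12)`** (Glasser's inequality, `T > −V − 1`). [ours] -/
theorem su2Pi_slope_le_sqrt_card_div_twelve :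
    1 / 2 * ∫ x, ∫ x', |∑ i, Real.cos (x i) - ∑ i, Real.cos (x' i)|
          ∂(Measure.pi fun _ : ι => (volume.restrict (Ioc (0 : ℝ) π)).withDensity
          fun α => ENNReal.ofReal (2 / π * Real.sin α ^ 2))
          ∂(Measure.pi fun _ : ι => (volume.restrict (Ioc (0 : ℝ) π)).withDensity
          fun α => ENNReal.ofReal (2 / π * Real.sin α ^ 2))
      ≤ Real.sqrt (Fintype.card ι / 12) := by
  haveI := su2ClassOne_isProbabilityMeasure
  obtain ⟨hL, -, -, -⟩ := su2Pi_sum_cos_moments (ι := ι)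
  have hTm : Measurable fun x : ι → ℝ => ∑ i, Real.cos (x i) :=
    Finset.measurable_sum _ fun i _ => Real.measurable_cos.comp (measurable_pi_apply i)
  have hC : ∀ x : ι → ℝ, -(Fintype.card ι : ℝ) - 1 < ∑ i, Real.cos (x i) := fun x => by
    have h : -∑ _i : ι, (1 : ℝ) ≤ ∑ i, Real.cos (x i) := by
      rw [← sum_neg_distrib]
      exact sum_le_sum fun i _ => Real.neg_one_le_cos _
    rw [sum_const, card_univ, nsmul_eq_mul, mul_one] at h
    linarith
  have h := half_integral_abs_sub_le_sqrt_variance_div_three hTm (hL.mono_exponent (by norm_num)) hC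
  rw [su2Pi_sum_cos_variance] at h
  calc _ ≤ Real.sqrt (Fintype.card ι / 4 / 3) := h
    _ = Real.sqrt (Fintype.card ι / 12) := by rw [div_div]; norm_num

/-- **THE `√V` LAW OF THE SU(2) STRONG-COUPLING SLOPE, BOTH SIDES**: `√(V/24) ≤ s_V ≤ √(V/12)` for
every `V`. [ours] -/
theorem su2Pi_slope_volume_sandwich :
    Real.sqrt (Fintype.card ι / 24)
        ≤ 1 / 2 * ∫ x, ∫ x', |∑ i, Real.cos (x i) - ∑ i, Real.cos (x' i)|
            ∂(Measure.pi fun _ : ι => (volume.restrict (Ioc (0 : ℝ) π)).withDensity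
          fun α => ENNReal.ofReal (2 / π * Real.sin α ^ 2))
            ∂(Measure.pi fun _ : ι => (volume.restrict (Ioc (0 : ℝ) π)).withDensity
          fun α => ENNReal.ofReal (2 / π * Real.sin α ^ 2))
      ∧ 1 / 2 * ∫ x, ∫ x', |∑ i, Real.cos (x i) - ∑ i, Real.cos (x' i)|
            ∂(Measure.pi fun _ : ι => (volume.restrict (Ioc (0 : ℝ) π)).withDensity
          fun α => ENNReal.ofReal (2 / π * Real.sin α ^ 2))
            ∂(Measure.pi fun _ : ι => (volume.restrict (Ioc (0 : ℝ) π)).withDensity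
          fun α => ENNReal.ofReal (2 / π * Real.sin α ^ 2))
          ≤ Real.sqrt (Fintype.card ι / 12) :=
  ⟨su2Pi_slope_ge_sqrt_card_div_twentyfour, su2Pi_slope_le_sqrt_card_div_twelve⟩

end Slope

end Summit.Ventures.LatticeQCDFlow.Theory2

end
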